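import Literature.AlgebraicGeometry.Frobenioids.CoprimarySteps
import Literature.AlgebraicGeometry.Frobenioids.PerfFactorialSupports
import HarnessLib

/-!
# Frobenioids I, Proposition 4.1 (Primary Steps), parts (ii)–(v) — proofs over the Frobenioid
# axioms: the (iv)/(v) translations into the language of monoids, and the assembly of all the
# categorical translations with the perf-factorial monoid statements

Mochizuki, *The geometry of Frobenioids I: the general theory*, Kyushu J. Math. **62** (2008)
293–400, §4, Proposition 4.1 (ii)–(v), statement p. 75–76, proof pp. 76–77
[cite: MochizukiFrdI2008, Prop. 4.1 p.75]. Standing data (p. 75): a Frobenioid `C → F_Φ` (`hF`) of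
perfect and isotropic type with `Φ` perf-factorial; steps `φ : B → A`, `ψ : A → C`, `δ : D → E`,
`ε : E → F`, `ι : I → F`.

Each part is PROVED as printed: the translation "into the language of monoids" by Definition 1.3
(iii)(d) (files `PrimarySteps.lean`, `CoprimarySteps.lean`, and the (iv)/(v) translations
`prop41iv_condition_iff` / `prop41v_condition_iff` proved first in this file: "for every primary
element `x_ε' ∉ 𝔭`, `x_ε' ≤ x_ε` if and only if `x_ε' ≤ x_δ + x_ε`", p. 77) followed
by the monoid statement over Definition 2.4 (i)(b)(c)(d) and "the fact that `Φ(A)` is perfect"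
(Prop. 1.10 (iii)) (files `PerfFactorialPrimes.lean`, `PerfFactorialSplitting.lean`,
`PerfFactorialSupports.lean`). The conclusions are rendered exactly as the bodies of the named
statements `PreFrobenioidData.Prop41ii`, `Prop41iii_criterion` (with the support predicate
instantiated by disjointness of the supports `Supp` of Def. 2.4 (i)(d) of the images in `Φ(F)^pf`),
`Prop41iii_square`, `Prop41iv`, `Prop41v` of the statement file
`DivisorMonoidCategoryTheoreticityDefs.lean` (seat abc-iut-L1-t3); part (i) is
`PreFrobenioid.isPrimaryPreStep_iff_of_isStep` (`PrimarySteps.lean`). Composition is diagrammatic;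
monoids are multiplicative. No new definitions.
-/

namespace Literature.AlgebraicGeometry.Frobenioids

open CategoryTheory Opposite

universe w v v' u u'

namespace PreFrobenioid

variable {D : Type u} [Category.{v} D] {Φ : Dᵒᵖ ⥤ CommMonCat.{w}}
  {C : Type u'} [Category.{v'} C] {F : C ⥤ ElemFrobenioid Φ}

/-! ## Proposition 4.1 (iv), (v): the translations into the language of monoids (FrdI p. 77) -/

/-! ### Factorisations through pre-steps ⟷ divisibility (Def. 1.3 (iii)(d)) -/

/-- Slice over `A` (second equivalence of Def. 1.3 (iii)(d)): for pre-steps `ψ : Y → A`, `χ : X → A`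
of a Frobenioid of isotropic type, `χ` factors through `ψ` by a pre-step iff `x_ψ ≤ x_χ` in `Φ(A)`.
[cite: MochizukiFrdI2008, Def. 1.3(iii) p.24] -/
theorem exists_preStep_over_iff_invDiv_dvd (hF : IsFrobenioid F) (histr : IsOfIsotropicType F)
    {X Y A : C} {χ : X ⟶ A} {ψ : Y ⟶ A} (hχ : IsPreStep F χ) (hψ : IsPreStep F ψ) :
    (∃ ζ : X ⟶ Y, IsPreStep F ζ ∧ ζ ≫ ψ = χ) ↔ invDiv F ψ hψ.2 ∣ invDiv F χ hχ.2 := by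
  have hco : ∀ {X Y : C} (f : X ⟶ Y), IsCoAngular F f :=
    fun f => isCoAngular_of_isIsotropic_codomains F f fun Z _ => histr Z
  constructor
  · rintro ⟨ζ, hζ, rfl⟩
    exact invDiv_dvd_invDiv_comp ζ ψ hψ hχ.2
  · intro h
    obtain ⟨ζ, hζco, hζ⟩ := hF.iii_d_over_full χ ψ ⟨hco χ, hχ⟩ ⟨hco ψ, hψ⟩ h
    exact ⟨ζ, hζco.2, hζ⟩

/-- Coslice under `A` (first equivalence of Def. 1.3 (iii)(d)): for pre-steps `φ : A → B`,
`χ : A → X` of a Frobenioid of isotropic type, `χ` factors through `φ` by a pre-step iff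
`Div φ ≤ Div χ` in `Φ(A)`. [cite: MochizukiFrdI2008, Def. 1.3(iii) p.24] -/
theorem exists_preStep_under_iff_div_dvd (hF : IsFrobenioid F) (histr : IsOfIsotropicType F)
    {A B X : C} {φ : A ⟶ B} {χ : A ⟶ X} (hφ : IsPreStep F φ) (hχ : IsPreStep F χ) :
    (∃ ζ : B ⟶ X, IsPreStep F ζ ∧ φ ≫ ζ = χ) ↔ Div F φ ∣ Div F χ := by
  have hP := hF.isPreFrobenioid
  have hD := hP.isTotallyEpimorphic_base
  have hco : ∀ {X Y : C} (f : X ⟶ Y), IsCoAngular F f :=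
    fun f => isCoAngular_of_isIsotropic_codomains F f fun Z _ => histr Z
  constructor
  · rintro ⟨ζ, hζ, rfl⟩
    rw [div_comp_of_isLinear φ hζ.1]
    exact Dvd.intro_left _ rfl
  · intro h
    obtain ⟨ζ, hζco, hζ⟩ := hF.iii_d_under_full φ χ ⟨hco φ, hφ⟩ ⟨hco χ, hχ⟩ h
    exact ⟨ζ, hζco.2, hζ⟩

/-! ### Proposition 4.1 (iv) -/

/-- **Proposition 4.1 (iv)**, the translation for a fixed `𝔭 ∈ Prime(Φ(F))` (FrdI p. 77): for steps
`δ : D → E`, `ε : E → F` of a Frobenioid of isotropic type, the condition "for every primary step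
`ε' : E' → F` with `ε'_*(Div ε') ∉ 𝔭`: `ε` factors through `ε'` by a pre-step iff `ε ∘ δ` does"
holds iff "for every primary element `x' ∉ 𝔭` of `Φ(F)`, `x' ≤ x_ε` if and only if
`x' ≤ x_δ + x_ε`" [`x_ε = ε_*(Div ε)`, `x_δ + x_ε = (ε ∘ δ)_*(Div(ε ∘ δ))`; second equivalence of
Def. 1.3 (iii)(d) over `F`]. [cite: MochizukiFrdI2008, Prop. 4.1 (iv) p.76] -/
theorem prop41iv_condition_iff (hF : IsFrobenioid F) (histr : IsOfIsotropicType F)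
    {D' E F' : C} {δ : D' ⟶ E} {ε : E ⟶ F'} (hδ : IsStep F δ) (hε : IsStep F ε)
    (𝔭 : Primes (Φ.obj (op (baseObj F F')))) :
    (∀ ⦃E' : C⦄ (ε' : E' ⟶ F'), IsStep F ε' → IsPrimaryPreStep F ε' →
        (∃ y, pull Φ (Base F ε') y = Div F ε' ∧ y ∉ 𝔭.carrier) →
          ((∃ ζ : E ⟶ E', IsPreStep F ζ ∧ ζ ≫ ε' = ε) ↔
            ∃ θ : D' ⟶ E', IsPreStep F θ ∧ θ ≫ ε' = δ ≫ ε)) ↔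
      ∀ x' : Φ.obj (op (baseObj F F')), IsPrimary x' → x' ∉ 𝔭.carrier →
        (x' ∣ invDiv F ε hε.1.2 ↔ x' ∣ invDiv F (δ ≫ ε) (IsPreStep.comp F hδ.1 hε.1).2) := by
  have hP := hF.isPreFrobenioid
  have hδε : IsPreStep F (δ ≫ ε) := IsPreStep.comp F hδ.1 hε.1
  constructor
  · intro hC x' hx' hx'𝔭
    -- realise `x'` by a primary step `ε' : E' → F` (Def. 1.3 (iii)(d), slice, ess. surjectivity)
    obtain ⟨E', ε', hε'co, hε'x⟩ := hF.iii_d_over_surj F' x'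
    haveI : IsIso (Base F ε') := hε'co.2.2
    have hε'div : Div F ε' = pull Φ (Base F ε') x' := by rw [← hε'x, pull_invDiv]
    have hε'step : IsStep F ε' := ⟨hε'co.2, fun _ => hx'.1 (by
      rw [← hε'x]; exact invDiv_eq_one_of_isIso hP ε' hε'co.2.2)⟩
    have hε'prim : IsPrimaryPreStep F ε' :=
      ⟨hε'co.2, by rw [hε'div]; exact (isPrimary_pull_iff _ _).mpr hx'⟩
    have h := hC ε' hε'step hε'prim ⟨x', hε'div.symm, hx'𝔭⟩
    rw [exists_preStep_over_iff_invDiv_dvd hF histr hε.1 hε'co.2,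
      exists_preStep_over_iff_invDiv_dvd hF histr hδε hε'co.2, hε'x] at h
    exact h
  · rintro hM E' ε' hε'step ⟨-, hε'prim⟩ ⟨y, hy, hy𝔭⟩
    haveI : IsIso (Base F ε') := hε'step.1.2
    have hyx : y = invDiv F ε' hε'step.1.2 :=
      pull_injective_of_isIso Φ (Base F ε') (by rw [hy, pull_invDiv])
    have hx'prim : IsPrimary (invDiv F ε' hε'step.1.2) := by
      unfold invDiv
      exact (isPrimary_pull_iff _ _).mpr hε'prim
    have h := hM _ hx'prim (hyx ▸ hy𝔭)
    rw [exists_preStep_over_iff_invDiv_dvd hF histr hε.1 hε'step.1,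
      exists_preStep_over_iff_invDiv_dvd hF histr hδε hε'step.1]
    exact h

/-! ### Proposition 4.1 (v) -/

/-- **Proposition 4.1 (v)**, the translation for a fixed `𝔭 ∈ Prime(Φ(D))` (FrdI p. 77, "by
reversing the direction of the arrows"): for steps `δ : D → E`, `ε : E → F` of a Frobenioid of
isotropic type, the condition "for every primary step `δ' : D → E'` with `Div(δ') ∉ 𝔭`: `δ` factors
through `δ'` by a pre-step iff `ε ∘ δ` does" holds iff "for every primary element `x' ∉ 𝔭` of
`Φ(D)`, `x' ≤ Div δ` if and only if `x' ≤ Div(ε ∘ δ)`" [first equivalence of Def. 1.3 (iii)(d)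
under `D`]. [cite: MochizukiFrdI2008, Prop. 4.1 (v) p.76] -/
theorem prop41v_condition_iff (hF : IsFrobenioid F) (histr : IsOfIsotropicType F)
    {D' E F' : C} {δ : D' ⟶ E} {ε : E ⟶ F'} (hδ : IsStep F δ) (hε : IsStep F ε)
    (𝔭 : Primes (Φ.obj (op (baseObj F D')))) :
    (∀ ⦃E' : C⦄ (δ' : D' ⟶ E'), IsStep F δ' → IsPrimaryPreStep F δ' → Div F δ' ∉ 𝔭.carrier →
        ((∃ ζ : E' ⟶ E, IsPreStep F ζ ∧ δ' ≫ ζ = δ) ↔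
          ∃ θ : E' ⟶ F', IsPreStep F θ ∧ δ' ≫ θ = δ ≫ ε)) ↔
      ∀ x' : Φ.obj (op (baseObj F D')), IsPrimary x' → x' ∉ 𝔭.carrier →
        (x' ∣ Div F δ ↔ x' ∣ Div F (δ ≫ ε)) := by
  have hP := hF.isPreFrobenioid
  have hδε : IsPreStep F (δ ≫ ε) := IsPreStep.comp F hδ.1 hε.1
  constructor
  · intro hC x' hx' hx'𝔭
    -- realise `x'` by a primary step `δ' : D → E'` (Def. 1.3 (iii)(d), coslice, ess. surjectivity)
    obtain ⟨E', δ', hδ'co, hδ'x⟩ := hF.iii_d_under_surj D' x'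
    have hδ'step : IsStep F δ' := ⟨hδ'co.2, fun _ => hx'.1 (by
      rw [← hδ'x]; exact isIsometry_of_isIso F hP δ')⟩
    have h := hC δ' hδ'step ⟨hδ'co.2, hδ'x.symm ▸ hx'⟩ (hδ'x.symm ▸ hx'𝔭)
    rw [exists_preStep_under_iff_div_dvd hF histr hδ'co.2 hδ.1,
      exists_preStep_under_iff_div_dvd hF histr hδ'co.2 hδε, hδ'x] at h
    exact h
  · rintro hM E' δ' hδ'step ⟨-, hδ'prim⟩ hδ'𝔭
    have h := hM _ hδ'prim hδ'𝔭
    rw [exists_preStep_under_iff_div_dvd hF histr hδ'step.1 hδ.1,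
      exists_preStep_under_iff_div_dvd hF histr hδ'step.1 hδε]
    exact h

/-! ### Proposition 4.1 (ii) -/

/-- **Proposition 4.1 (ii)** (FrdI p. 75): for a Frobenioid of perfect and isotropic type with `Φ`
perf-factorial, a primary step `φ : B → A` and a step `ψ : A → C`, the composite `ψ ∘ φ` [and then
also `ψ`] is primary iff every factorisation `ψ ∘ φ = ψ' ∘ φ'` into steps admits a step
`φ'' : B → A''` and pre-steps `ζ : A'' → A`, `ζ' : A'' → A'` with `φ = ζ ∘ φ''`, `φ' = ζ' ∘ φ''`.
[cite: MochizukiFrdI2008, Prop. 4.1 (ii) p.75] -/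
theorem isPrimaryPreStep_comp_iff_of_isStep (hF : IsFrobenioid F) (hperf : IsOfPerfectType F)
    (histr : IsOfIsotropicType F) (hpf : Objectwise (fun M _ => IsPerfFactorial M) Φ) {B A C' : C}
    {φ : B ⟶ A} {ψ : A ⟶ C'} (hφ : IsStep F φ) (hφp : IsPrimaryPreStep F φ) (hψ : IsStep F ψ) :
    (IsPrimaryPreStep F (φ ≫ ψ) ∧ IsPrimaryPreStep F ψ) ↔
      ∀ ⦃A' : C⦄ (φ' : B ⟶ A') (ψ' : A' ⟶ C'), IsStep F φ' → IsStep F ψ' → φ' ≫ ψ' = φ ≫ ψ →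
        ∃ (A'' : C) (φ'' : B ⟶ A'') (ζ : A'' ⟶ A) (ζ' : A'' ⟶ A'),
          IsStep F φ'' ∧ IsPreStep F ζ ∧ IsPreStep F ζ' ∧ φ'' ≫ ζ = φ ∧ φ'' ≫ ζ' = φ' := by
  haveI : IsIso (Base F φ) := hφ.1.2
  have hY : pull Φ (Base F φ) (Div F ψ) ≠ 1 := fun h => div_ne_one_of_isStep histr hψ
    (pull_injective_of_isIso Φ (Base F φ) (by rw [h, map_one]))
  have hdiv : Div F (φ ≫ ψ) = Div F φ * pull Φ (Base F φ) (Div F ψ) := by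
    rw [div_comp_of_isLinear φ hψ.1.1, mul_comm]
  rw [primaryComposite_condition_iff hF histr hφ hψ,
    ← (hpf (baseObj F B)).isPrimary_mul_iff_of_isPerfect (isPerfect_divisorMonoid hF hperf B) hφp.2
      hY, ← hdiv]
  constructor
  · exact fun h => h.1.2
  · intro h
    refine ⟨⟨IsPreStep.comp F hφ.1 hψ.1, h⟩, hψ.1, ?_⟩
    have h1 : IsPrimary (pull Φ (Base F φ) (Div F ψ)) :=
      h.of_precsim (Precsim.of_dvd (Dvd.intro_left _ hdiv.symm)) hY
    exact (isPrimary_pull_iff _ _).mp h1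

/-! ### Proposition 4.1 (iii) -/

/-- **Proposition 4.1 (iii)**, criterion (FrdI p. 75): for steps `ε : E → F`, `ι : I → F` and the
elements `y_ε = ε_*(Div ε)`, `y_ι = ι_*(Div ι)` of `Φ(F)` [characterised by `Base(ε)^* y_ε = Div ε`,
`Base(ι)^* y_ι = Div ι`], `y_ε`, `y_ι` have disjoint supports [`Supp` of Def. 2.4 (i)(d), taken on the
images in `Φ(F)^pf`] iff `ε`, `ι` are co-primary. [cite: MochizukiFrdI2008, Prop. 4.1 (iii) p.75] -/
theorem disjoint_supp_iff_isCoprimary (hF : IsFrobenioid F) (hperf : IsOfPerfectType F)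
    (histr : IsOfIsotropicType F) (hpf : Objectwise (fun M _ => IsPerfFactorial M) Φ) {E I F' : C}
    {ε : E ⟶ F'} {ι : I ⟶ F'} (hε : IsStep F ε) (hι : IsStep F ι)
    (yε yι : Φ.obj (op (baseObj F F'))) (hyε : pull Φ (Base F ε) yε = Div F ε)
    (hyι : pull Φ (Base F ι) yι = Div F ι) :
    Disjoint (supp (factorMap _ (Perfection.of _ yε))) (supp (factorMap _ (Perfection.of _ yι))) ↔
      ∀ ⦃Z : C⦄ (ζ : Z ⟶ F'), IsPreStep F ζ →
        (∃ (ε' : E ⟶ Z) (ι' : I ⟶ Z), IsPreStep F ε' ∧ IsPreStep F ι' ∧ ε' ≫ ζ = ε ∧ ι' ≫ ζ = ι) →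
          IsIso ζ := by
  haveI : IsIso (Base F ε) := hε.1.2
  haveI : IsIso (Base F ι) := hι.1.2
  have h1 : yε = invDiv F ε hε.1.2 := pull_injective_of_isIso Φ (Base F ε) (by rw [hyε, pull_invDiv])
  have h2 : yι = invDiv F ι hι.1.2 := pull_injective_of_isIso Φ (Base F ι) (by rw [hyι, pull_invDiv])
  rw [h1, h2, isCoprimary_iff_forall_dvd hF histr hε.1 hι.1,
    (hpf (baseObj F F')).forall_common_dvd_eq_one_iff_disjoint_supp (isPerfect_divisorMonoid hF hperf F')]

/-- **Proposition 4.1 (iii)**, cartesian square (FrdI pp. 75–76): co-primary steps `ε : E → F`,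
`ι : I → F` admit pre-steps `ε' : U → E`, `ι' : U → I` with `ε ∘ ε' = ι ∘ ι'`, cartesian in the
category of pre-steps, with `ε_*(ε'_*(Div ε')) = ι_*(Div ι)`, `ι_*(ι'_*(Div ι')) = ε_*(Div ε)`; if
`ε, ι` are primary, so are `ε', ι'`. [cite: MochizukiFrdI2008, Prop. 4.1 (iii) p.75] -/
theorem exists_coprimary_square_of_isCoprimary (hF : IsFrobenioid F) (hperf : IsOfPerfectType F)
    (histr : IsOfIsotropicType F) (hpf : Objectwise (fun M _ => IsPerfFactorial M) Φ) {E I F' : C}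
    {ε : E ⟶ F'} {ι : I ⟶ F'} (hε : IsStep F ε) (hι : IsStep F ι)
    (hcop : ∀ ⦃Z : C⦄ (ζ : Z ⟶ F'), IsPreStep F ζ →
      (∃ (ε' : E ⟶ Z) (ι' : I ⟶ Z), IsPreStep F ε' ∧ IsPreStep F ι' ∧ ε' ≫ ζ = ε ∧ ι' ≫ ζ = ι) →
        IsIso ζ) :
    ∃ (U : C) (ε' : U ⟶ E) (ι' : U ⟶ I), IsPreStep F ε' ∧ IsPreStep F ι' ∧ ε' ≫ ε = ι' ≫ ι ∧
      (∀ ⦃V : C⦄ (a : V ⟶ E) (b : V ⟶ I), IsPreStep F a → IsPreStep F b → a ≫ ε = b ≫ ι →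
          ∃! u : V ⟶ U, u ≫ ε' = a ∧ u ≫ ι' = b) ∧
      (∀ yι : Φ.obj (op (baseObj F F')), pull Φ (Base F ι) yι = Div F ι →
          pull Φ (Base F (ε' ≫ ε)) yι = Div F ε') ∧
      (∀ yε : Φ.obj (op (baseObj F F')), pull Φ (Base F ε) yε = Div F ε →
          pull Φ (Base F (ι' ≫ ι)) yε = Div F ι') ∧
      (IsPrimaryPreStep F ε → IsPrimaryPreStep F ι → IsPrimaryPreStep F ε' ∧ IsPrimaryPreStep F ι') :=
  exists_coprimary_square hF histr hε.1 hι.1 fun _ hdε hdι =>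
    (hpf (baseObj F F')).mul_dvd_of_forall_common_dvd_eq_one (isPerfect_divisorMonoid hF hperf F')
      ((isCoprimary_iff_forall_dvd hF histr hε.1 hι.1).mp hcop) hdε hdι

/-! ### Proposition 4.1 (iv) -/

/-- **Proposition 4.1 (iv)** (FrdI p. 76): for steps `δ : D → E`, `ε : E → F`, `δ` is primary iff there
is `𝔭 ∈ Prime(Φ(F))` such that for every primary step `ε' : E' → F` with `ε'_*(Div ε') ∉ 𝔭`, `ε`
factors through `ε'` by a pre-step iff `ε ∘ δ` does. [cite: MochizukiFrdI2008, Prop. 4.1 (iv) p.76] -/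
theorem isPrimaryPreStep_iff_exists_prime_over (hF : IsFrobenioid F) (hperf : IsOfPerfectType F)
    (histr : IsOfIsotropicType F) (hpf : Objectwise (fun M _ => IsPerfFactorial M) Φ) {D' E F' : C}
    {δ : D' ⟶ E} {ε : E ⟶ F'} (hδ : IsStep F δ) (hε : IsStep F ε) :
    IsPrimaryPreStep F δ ↔
      ∃ 𝔭 : Primes (Φ.obj (op (baseObj F F'))), ∀ ⦃E' : C⦄ (ε' : E' ⟶ F'), IsStep F ε' →
        IsPrimaryPreStep F ε' → (∃ y, pull Φ (Base F ε') y = Div F ε' ∧ y ∉ 𝔭.carrier) →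
          ((∃ ζ : E ⟶ E', IsPreStep F ζ ∧ ζ ≫ ε' = ε) ↔
            ∃ θ : D' ⟶ E', IsPreStep F θ ∧ θ ≫ ε' = δ ≫ ε) := by
  have hδε : IsPreStep F (δ ≫ ε) := IsPreStep.comp F hδ.1 hε.1
  haveI : IsIso (Base F (δ ≫ ε)) := hδε.2
  haveI : IsIso (Base F ε) := hε.1.2
  -- `x_δ + x_ε = x_ε · T` with `T` the transport of `Div δ` to `Φ(F)`
  have hT : invDiv F (δ ≫ ε) hδε.2 =
      invDiv F ε hε.1.2 * pull Φ (inv (Base F (δ ≫ ε))) (Div F δ) := by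
    apply pull_injective_of_isIso Φ (Base F (δ ≫ ε))
    rw [pull_invDiv, map_mul, pull_base_comp_invDiv, ← pull_comp, IsIso.hom_inv_id, pull_id,
      div_comp_of_isLinear δ hε.1.1]
  have hT1 : pull Φ (inv (Base F (δ ≫ ε))) (Div F δ) ≠ 1 := fun h => div_ne_one_of_isStep histr hδ
    (pull_injective_of_isIso Φ (inv (Base F (δ ≫ ε))) (by rw [h, map_one]))
  have hmon := (hpf (baseObj F F')).isPrimary_iff_exists_prime_dvd_iff
    (isPerfect_divisorMonoid hF hperf F') (invDiv F ε hε.1.2) hT1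
  rw [← hT] at hmon
  constructor
  · rintro ⟨-, hprim⟩
    obtain ⟨𝔭, h𝔭⟩ := hmon.mp ((isPrimary_pull_iff _ _).mpr hprim)
    exact ⟨𝔭, (prop41iv_condition_iff hF histr hδ hε 𝔭).mpr h𝔭⟩
  · rintro ⟨𝔭, h𝔭⟩
    exact ⟨hδ.1, (isPrimary_pull_iff _ _).mp
      (hmon.mpr ⟨𝔭, (prop41iv_condition_iff hF histr hδ hε 𝔭).mp h𝔭⟩)⟩

/-! ### Proposition 4.1 (v) -/

/-- **Proposition 4.1 (v)** (FrdI p. 76): for steps `δ : D → E`, `ε : E → F`, `ε` is primary iff there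
is `𝔭 ∈ Prime(Φ(D))` such that for every primary step `δ' : D → E'` with `Div(δ') ∉ 𝔭`, `δ` factors
through `δ'` by a pre-step iff `ε ∘ δ` does. [cite: MochizukiFrdI2008, Prop. 4.1 (v) p.76] -/
theorem isPrimaryPreStep_iff_exists_prime_under (hF : IsFrobenioid F) (hperf : IsOfPerfectType F)
    (histr : IsOfIsotropicType F) (hpf : Objectwise (fun M _ => IsPerfFactorial M) Φ) {D' E F' : C}
    {δ : D' ⟶ E} {ε : E ⟶ F'} (hδ : IsStep F δ) (hε : IsStep F ε) :
    IsPrimaryPreStep F ε ↔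
      ∃ 𝔭 : Primes (Φ.obj (op (baseObj F D'))), ∀ ⦃E' : C⦄ (δ' : D' ⟶ E'), IsStep F δ' →
        IsPrimaryPreStep F δ' → Div F δ' ∉ 𝔭.carrier →
          ((∃ ζ : E' ⟶ E, IsPreStep F ζ ∧ δ' ≫ ζ = δ) ↔
            ∃ θ : E' ⟶ F', IsPreStep F θ ∧ δ' ≫ θ = δ ≫ ε) := by
  haveI : IsIso (Base F δ) := hδ.1.2
  have hde : Div F (δ ≫ ε) = Div F δ * pull Φ (Base F δ) (Div F ε) := by
    rw [div_comp_of_isLinear δ hε.1.1, mul_comm]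
  have he1 : pull Φ (Base F δ) (Div F ε) ≠ 1 := fun h => div_ne_one_of_isStep histr hε
    (pull_injective_of_isIso Φ (Base F δ) (by rw [h, map_one]))
  have hmon := (hpf (baseObj F D')).isPrimary_iff_exists_prime_dvd_iff
    (isPerfect_divisorMonoid hF hperf D') (Div F δ) he1
  rw [← hde] at hmon
  constructor
  · rintro ⟨-, hprim⟩
    obtain ⟨𝔭, h𝔭⟩ := hmon.mp ((isPrimary_pull_iff _ _).mpr hprim)
    exact ⟨𝔭, (prop41v_condition_iff hF histr hδ hε 𝔭).mpr h𝔭⟩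
  · rintro ⟨𝔭, h𝔭⟩
    exact ⟨hε.1, (isPrimary_pull_iff _ _).mp
      (hmon.mpr ⟨𝔭, (prop41v_condition_iff hF histr hδ hε 𝔭).mp h𝔭⟩)⟩

end PreFrobenioid

end Literature.AlgebraicGeometry.Frobenioids
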